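import Summits.ResolutionOfSingularities.ResolutionOfSingularities.Theorems.StallVertexStraightClasses
import HarnessLib

/-!
# StallVertexEcho — decomp-res node «StallVertex» (lens-5 g22 rev 7/8), add-on tree file 17 of the node

Content VERBATIM from the decomp-res lens-5 file `HOME/decomp-res-lens-5/g22/StallVertex.lean` rev 8 (pin 9799ca34,
4 539 l; rev 8 = rev 7 25c16fe6 +
five pure insertions §1j/§1k/§2d/§3i/§4i/§4j; rev 7 = pure insertions §2c/§4h over the landed rev-6 content
95ed6f6f — all earlier statements
byte-identical (critic machine diffs, CRITIC-LEDGER rows 142g / 142h); HOME = run/shared/lean/pub/decomp-res).  The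
rev-0…6 sections are ALREADY in the
tree (`StallVertexForms` / `Kernels` / `Walk` / `Classes` / `Clean` / `Rigid` / `Lines` / `RigidClasses` / `Carry` /
`OldLetter` / `LineTurn` /
`LetterClasses` / `Regime` / `StraightClasses` + wiring `MaxContactCutStallVertex` /
`MaxContactCutStallVertexEvents`, writer g7/g8); the rev-7/8 add-on
files carry ONLY the 53 declarations NEW in rev 7 / rev 8.  Critic: CRITIC-LEDGER row 142g (rev 7, DECIDED +1 (Y):
THE DEFICIENCY LAW — the positive
young-monomial regime is EMPTY, positive differential shade is an interference phenomenon, exact re-location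
`monomialRegime_iff_flat`; inhabitants
T-regime 3 353/116; 2026-08-30T23:43:05Z) and row 142h (rev 8, BOOKED 0: RESONANCE / ECHO / NULL / COINCIDENCE laws
+ the exact two-leaf split
`defectWalksDeep_iff_positive_nullFlat`; 2026-08-31T00:03:14Z) — landing orders INBOX :525 / :543.  Landed by
decomp-res writer g9 as
`StallVertexEcho` (§1j + §1k + §3i), `StallVertexDeficiency` (§2c + §2d), `StallVertexDeficiencyLaw` (§4h
kernels: `FlatMonomialAt` … `muTilde_eq_zero_of_regime`),
`StallVertexFlatClasses` (§4h cells and exact re-locations), `StallVertexNullClasses` (§4i + §4j cells and exact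
re-locations) and the wiring file
`MaxContactCutStallVertexFlat` (every new `closes_…` / `defectWalksDeep_iff_…` BY NAME on
`MaxContactCut.DefectWalksDeep`).  All
`--supports stmt-ResolutionOfSingularities-31770`.  Every file of the node is in the Theses cone (the lens imports
the in-cone `DifferentialShade`), so the
located residual is booked on the route by RE-LOCATING the existing aside 28122 `CFNoSkewJointTailsDeep` (informal-only edit) to
`StallVertex.NoFlatRegimeSkewStalledTailsDeep` ≡ `NoPositiveSkewStalledTailsDeep ∧
NoNullFlatSkewStalledTailsDeep` (EXACT, hypothesis-free chain
skew ↔ … ↔ monomialRegime ↔ flat ↔ positive ∧ nullFlat: `skew_iff_flat`, `skew_iff_positive_nullFlat`)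
— one aside on this column (critic rows 142g/142h:
«file only the newest, exactly one aside on the column; decided cells and the μ̃-sign leaves NOT filed»).

§1j (rev 8, `section Algebra`) RESONANCE and ECHO (generic): `aeval_flat_of_free`, **`resonance`** (an UNCLEAN move
whose order nevertheless attains the
vertex value splits the new initial form into the two-layer cone `u_j^{d−a}·(in_n dirForm + u_j·in_m tailForm)`,
`m + 1 = n`), `ordZero_dirForm_two_layer`;
§1k (rev 8) A BOUNDARY MONOMIAL CONE CANNOT INTERFERE — **`clean_of_boundary_cone`**; §3i (rev 8, `section
Walk`) THE ECHO LAW at walk level —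
**`echo_law`** (an interference is never followed by an untranslated move in the same chart).  PROVED, 0 sorry.
Imports the landed
`StallVertexStraightClasses` (top of the rev-0…6 chain).

[WRITER NOTE (decomp-res writer g9): file split only; namespace, opens, section variables and every declaration
exactly as in the lens (global `set_option` dropped; the lens's `set_option maxHeartbeats … in` lines kept; the
lens's private copy `flat_monomial'` of the landed
`Literature.AlgebraicGeometry.Resolution.PointBlowup.flat_monomial` is cited by its full name, as in `StallVertexCarry`).]

(Sources: KawanoueMatsuki2016 Prop. 4 (2), §4.1; Kawanoue2007 Lemma 2.2.1.2; BierstoneGrigorievMilmanWlodarczyk2011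
Def. 3.1.3; Hauser2010; HauserPerlega2024; Moh1987; CossartPiltant2008; Giraud1975; Hironaka1964; ZariskiSamuelII Ch. VIII §2.)
-/

noncomputable section

open MvPolynomial Finset
open Literature.AlgebraicGeometry.Resolution
open Literature.AlgebraicGeometry.Resolution.Hauser2010
open Literature.AlgebraicGeometry.Resolution.HauserPerlega2024
open Literature.Barriers.ResolutionOfSingularities
open Literature.AlgebraicGeometry.Resolution.PointBlowup
open Summit.ResolutionOfSingularities.ResolutionOfSingularities.Theses
open Summit.ResolutionOfSingularities.ResolutionOfSingularities.Theorems.TightDefectClasses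
open Summit.ResolutionOfSingularities.ResolutionOfSingularities.Theorems.ProximityCut
open Summit.ResolutionOfSingularities.ResolutionOfSingularities.Theorems.ExitLaw
open Summit.ResolutionOfSingularities.ResolutionOfSingularities.Theorems.DifferentialShade

namespace Summit.ResolutionOfSingularities.ResolutionOfSingularities.Theorems.StallVertex

section Algebra

variable {σ : Type*} {K : Type*} [Field K] [Fintype σ] [DecidableEq σ]

/-! ### §1j RESONANCE and ECHO (generic).  An UNCLEAN move whose order nevertheless attains the vertex value
`(d − a) + n` (as every STALLED move does, `stall_rigid` (2)) is RESONANT: the tail reaches the direction form EXACTLY,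
`1 + ord₀ tailForm = n`, and the new tangent cone is the TWO-LAYER form `u_j^{d−a}·(in_n(dirForm) +
u_j·in_{n−1}(tailForm))`
(`resonance`).  From a two-layer cone an UNTRANSLATED move in the SAME chart has vertex order `< n`
(`ordZero_dirForm_two_layer`): the tail layer, dehomogenised at `u_j ↦ 1`, drops strictly below degree `n` and cannot be
cancelled by the `u_j`-free direction layer.  [new] -/

/-- Dehomogenising at `u_j ↦ 1` fixes a `u_j`-free polynomial. [folklore] -/
theorem aeval_flat_of_free {j : σ} {A : MvPolynomial σ K} (hAj : ∀ s ∈ A.support, s j = 0) :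
    aeval (fun i => if i = j then (1 : MvPolynomial σ K) else X i) A = A := by
  conv_rhs => rw [A.as_sum]
  conv_lhs => rw [A.as_sum]
  rw [map_sum]
  refine Finset.sum_congr rfl fun s hs => ?_
  rw [Literature.AlgebraicGeometry.Resolution.PointBlowup.flat_monomial, Finsupp.erase_of_notMem_support]
  rw [Finsupp.mem_support_iff, not_not]
  exact hAj s hs

omit [Fintype σ] in
/-- **RESONANCE.**  For a move `(j, b)` (`b_j = 0`) of a generator `G` of order `d` carried at level `a ≤ d`, with vertex
order `n = ord₀ dirForm`: if the move is NOT clean but the order of the transform is the vertex value `(d − a) + n`, then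
`ord₀ tailForm = n − 1` EXACTLY (a deeper tail would drag the order below the vertex value) and the initial form of the
transform is `u_j^{d−a} · (in_n(dirForm) + u_j · in_{n−1}(tailForm))` with BOTH layers non-zero. [new] [folklore] -/
theorem resonance (b : σ → K) {j : σ} (hbj : b j = 0) {a d : ℕ} (had : a ≤ d)
    {G : MvPolynomial σ K} (hd : ordZero G = d) {n : ℕ} (hn : ordZero (dirForm d j b G) = n)
    (hstall : ordZero (PointBlowup.translate b (chartTransform a j G)) = ((d - a + n : ℕ) : ℕ∞))
    (hunc : ¬ CleanMove d j b G) :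
    ∃ m : ℕ, m + 1 = n ∧ ordZero (tailForm d j b G) = m ∧
      homogeneousComponent m (tailForm d j b G) ≠ 0 ∧
      homogeneousComponent (d - a + n) (PointBlowup.translate b (chartTransform a j G)) =
        X j ^ (d - a) * (homogeneousComponent n (dirForm d j b G) +
          X j * homogeneousComponent m (tailForm d j b G)) := by
  set D := dirForm d j b G with hD
  set T := tailForm d j b G with hT
  have hunc' : 1 + ordZero T ≤ (n : ℕ∞) := by rw [← hn]; exact not_lt.mp hunc
  have hT0 : T ≠ 0 := by
    intro h0
    rw [h0, ordZero_zero, add_top, top_le_iff] at hunc'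
    exact ENat.coe_ne_top n hunc'
  obtain ⟨m, hm⟩ := exists_ordZero_eq_natCast hT0
  have hmn : 1 + m ≤ n := by rw [hm] at hunc'; exact_mod_cast hunc'
  have hmove := move_eq_layer b hbj had hd
  have heq : m + 1 = n := by
    by_contra hne
    have hlt : 1 + m < n := by omega
    have hlt' : ordZero (X j * T) < ordZero D := by
      rw [ordZero_mul, ordZero_X, hm, hn]; exact_mod_cast hlt
    have hsum : ordZero (D + X j * T) = ((1 + m : ℕ) : ℕ∞) := by
      rw [add_comm, ordZero_add_eq_left_of_lt hlt', ordZero_mul, ordZero_X, hm, Nat.cast_add, Nat.cast_one]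
    have h := hstall
    rw [hmove, ordZero_mul, ordZero_X_pow, hsum, ← Nat.cast_add] at h
    have : d - a + (1 + m) = d - a + n := by exact_mod_cast h
    omega
  refine ⟨m, heq, hm, homogeneousComponent_ne_zero_of_ordZero_eq hm, ?_⟩
  have hXT : homogeneousComponent n (X j * T) = X j * homogeneousComponent m T := by
    have h1 := homogeneousComponent_X_pow_mul j 1 m T
    rw [pow_one, add_comm] at h1
    rw [← heq]; exact h1
  rw [hmove, homogeneousComponent_X_pow_mul, map_add, hXT]

/-- **THE ECHO INEQUALITY.**  Let the initial form of `P` in degree `e + n` be a TWO-LAYER form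
`u_j^e · (A + u_j · B)` with `A` a `u_j`-free polynomial of order `n` (in practice the degree-`n` direction layer), and
`B ≠ 0` with all monomials of degree `m = n − 1`.  Then the UNTRANSLATED move in the chart `u_j` has direction form
`A + B(u_j ↦ 1)` of order `≤ m < n`: the dehomogenised tail layer lies strictly below degree `n`. [new] [folklore] -/
theorem ordZero_dirForm_two_layer {j : σ} {e n m : ℕ} (hmn : m + 1 = n) {P A B : MvPolynomial σ K}
    (hordA : ordZero A = n) (hAj : ∀ s ∈ A.support, s j = 0)
    (hBdeg : ∀ s ∈ B.support, s.degree = m) (hB0 : B ≠ 0)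
    (hP : homogeneousComponent (e + n) P = X j ^ e * (A + X j * B)) {b : σ → K} (hb : ∀ i, b i = 0) :
    ordZero (dirForm (e + n) j b P) < n := by
  classical
  have hΦ : ∀ s ∈ (homogeneousComponent (e + n) P).support, s.degree = e + n :=
    fun s hs => degree_eq_of_mem_support_homogeneousComponent hs
  unfold dirForm
  rw [translate_eq_self hb, chartTransform_form_eq_aeval j hΦ, hP]
  simp only [map_mul, map_pow, map_add, aeval_X, if_true, one_pow, one_mul]
  rw [aeval_flat_of_free hAj, ← chartTransform_form_eq_aeval j hBdeg]
  set B' := chartTransform m j B with hB'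
  have hB'0 : B' ≠ 0 := chartTransform_ne_zero m j hB0 (fun d hd => (hBdeg d hd).ge)
  have hordB' : ordZero B' ≤ m := by
    obtain ⟨s', hs'⟩ := MvPolynomial.ne_zero_iff.mp hB'0
    obtain ⟨s, hs, hss'⟩ := exists_of_mem_support_chartTransform (MvPolynomial.mem_support_iff.mpr hs')
    have hle : s' ≤ s := by
      intro i
      rw [← hss', chartExponent_apply]
      by_cases hij : i = j
      · rw [if_pos hij, hBdeg s hs, Nat.sub_self]; exact Nat.zero_le _
      · rw [if_neg hij]
    have hdeg : s'.degree ≤ m := by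
      have h := tsub_add_cancel_of_le hle
      have := congrArg Finsupp.degree h
      rw [map_add, hBdeg s hs] at this
      omega
    exact (ordZero_le_of_coeff_ne_zero _ _ hs').trans (by exact_mod_cast hdeg)
  have hmn' : (m : ℕ∞) < n := by exact_mod_cast (by omega : m < n)
  have hlt : ordZero B' < ordZero A := by rw [hordA]; exact lt_of_le_of_lt hordB' hmn'
  rw [add_comm, ordZero_add_eq_left_of_lt hlt]
  exact lt_of_le_of_lt hordB' hmn'

/-! ### §1k (rev 8, generation 22) A BOUNDARY MONOMIAL CONE CANNOT INTERFERE

If the cone of `G` is a MONOMIAL `ρ·u^S` and every kept letter divides the whole series to its cone exponent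
(`u_i^{S_i} ∣ G` for `i ≠ j`, `b_i = 0`), a move attaining the vertex value `ord₀ G' = d − a + n` is CLEAN: by
RESONANCE an unclean move puts a monomial `u_j^{d−a+1}·u^{s'}` (`u^{s'}` a monomial of `in_{n−1} T`) into the cone
of `G'`, of degree `d − a + n`; kept divisibility is transported (`divisorOrder_le_divisorOrder_kept`), so that
monomial carries `Σ_kept ≥ Σ_kept S_i = n` besides `u_j^{≥ d−a+1}` — degree `> d − a + n`. -/

/-- **A BOUNDARY MONOMIAL CONE CANNOT INTERFERE** (see the section docstring). [new] [folklore] -/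
theorem clean_of_boundary_cone [DecidableEq K] (b : σ → K) {j : σ} (hbj : b j = 0) {a d : ℕ} (had : a ≤ d)
    {G : MvPolynomial σ K} (hd : ordZero G = d) {S : σ →₀ ℕ} {ρ : K} (hρ : ρ ≠ 0)
    (hG : homogeneousComponent d G = monomial S ρ)
    (hdiv : ∀ i, i ≠ j → b i = 0 → ((S i : ℕ) : ℕ∞) ≤ divisorOrder i G)
    {n : ℕ} (hn : ordZero (dirForm d j b G) = n)
    (hstall : ordZero (PointBlowup.translate b (chartTransform a j G)) = ((d - a + n : ℕ) : ℕ∞)) :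
    CleanMove d j b G := by
  classical
  by_contra hunc
  obtain ⟨m, hmn, -, hB0, hcone⟩ := resonance b hbj had hd hn hstall hunc
  -- `n = Σ_kept S_i`
  have hnS : (∑ i ∈ univ.filter (fun i => ¬ (i = j ∨ b i ≠ 0)), S i) = n := by
    have h := hn
    rw [dirForm_eq_dehom, hG, ordZero_dehom_monomial j b S hρ] at h
    exact_mod_cast h
  -- the offending monomial `u_j^{d-a+1} u^{s'}` of the cone of `G'`
  set G' := PointBlowup.translate b (chartTransform a j G) with hG'
  have hAj : ∀ s ∈ (homogeneousComponent n (dirForm d j b G)).support, s j = 0 := fun s hs =>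
    dirForm_free d b hbj G s (mem_support_of_mem_support_homogeneousComponent hs)
  obtain ⟨s', hs'⟩ := MvPolynomial.ne_zero_iff.mp hB0
  set m' : σ →₀ ℕ := s' + Finsupp.single j (d - a + 1) with hm'
  have hcoeff : coeff m' (homogeneousComponent (d - a + n) G') =
      coeff s' (homogeneousComponent m (tailForm d j b G)) := by
    rw [hcone, mul_add, ← mul_assoc, ← pow_succ, coeff_add]
    have h1 : coeff m' (X j ^ (d - a) * homogeneousComponent n (dirForm d j b G)) = 0 := by
      rw [X_pow_eq_monomial, coeff_monomial_mul', one_mul]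
      split_ifs with hle
      · by_contra hne
        have hmem := MvPolynomial.mem_support_iff.mpr hne
        have h0 := hAj _ hmem
        rw [hm', Finsupp.tsub_apply, Finsupp.add_apply, Finsupp.single_eq_same, Finsupp.single_eq_same] at h0
        omega
      · rfl
    have h2 : coeff m' (X j ^ (d - a + 1) * homogeneousComponent m (tailForm d j b G)) =
        coeff s' (homogeneousComponent m (tailForm d j b G)) := by
      rw [X_pow_eq_monomial, coeff_monomial_mul', one_mul, if_pos (by rw [hm']; exact le_add_self), hm',
        add_tsub_cancel_right]
    rw [h1, h2, zero_add]
  have hm'c : m' ∈ (homogeneousComponent (d - a + n) G').support := by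
    rw [MvPolynomial.mem_support_iff, hcoeff]; exact hs'
  have hm'deg : m'.degree = d - a + n := degree_eq_of_mem_support_homogeneousComponent hm'c
  have hm'G : m' ∈ G'.support := mem_support_of_mem_support_homogeneousComponent hm'c
  -- kept divisibility transported: `m'_i ≥ S_i` for every kept letter
  have hkept : ∀ i ∈ univ.filter (fun i => ¬ (i = j ∨ b i ≠ 0)), S i ≤ m' i := by
    intro i hi
    rw [Finset.mem_filter, not_or, not_not] at hi
    obtain ⟨-, hij, hbi⟩ := hi
    have h1 : ((S i : ℕ) : ℕ∞) ≤ divisorOrder i G' :=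
      (hdiv i hij hbi).trans (divisorOrder_le_divisorOrder_kept b hij hbi a G)
    have h2 : divisorOrder i G' ≤ (m' i : ℕ∞) := divisorOrder_le_exponent hm'G
    exact_mod_cast h1.trans h2
  have hsum : ∑ i ∈ univ.filter (fun i => ¬ (i = j ∨ b i ≠ 0)), S i ≤
      ∑ i ∈ univ.filter (fun i => ¬ (i = j ∨ b i ≠ 0)), m' i := Finset.sum_le_sum hkept
  have hjnot : j ∉ univ.filter (fun i => ¬ (i = j ∨ b i ≠ 0)) := by simp
  have hdeg_univ : ∑ i, m' i = m'.degree := by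
    rw [Finsupp.degree_eq_sum]
  have hins : m' j + ∑ i ∈ univ.filter (fun i => ¬ (i = j ∨ b i ≠ 0)), m' i ≤ m'.degree := by
    rw [← Finset.sum_insert hjnot, ← hdeg_univ]
    exact Finset.sum_le_sum_of_subset (Finset.subset_univ _)
  have hm'j : d - a + 1 ≤ m' j := by
    rw [hm', Finsupp.add_apply, Finsupp.single_eq_same]; omega
  omega

end Algebra

section Walk

variable {K : Type} [Field K] [DecidableEq K]

variable {q : ℕ} {s₀ : State (Fin 3) K}

/-! ### §3i THE ECHO LAW (walk level): an interference is never followed by an untranslated move in the same chart -/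

/-- **THE ECHO LAW.**  On two consecutive STALLED moves `t`, `t + 1` of a root walk, if the move at `t + 1` is taken in
the SAME chart as the move at `t` and WITHOUT translation, then the move at `t` was CLEAN for every `μ_P`-minimiser.
Reason: were it unclean, `resonance` makes the new cone the two-layer form `u_j^{d₀−a₀}·(A + u_j·B)`, `B ≠ 0`; the
untranslated `u_j`-chart move reads the direction form `A + B(u_j ↦ 1)` of order `< n` (`ordZero_dirForm_two_layer`),
while stall rigidity at `t + 1` (`stall_rigid` (1), lost letter = the newest divisor alone, of mass `μ_P − 1` by
`stall_rigid` (5)) forces the vertex order to be exactly `n` again.  Contrapositive: AFTER AN INTERFERENCE THE WALK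
TRANSLATES OR CHANGES CHART. [new] [folklore] -/
theorem echo_law {p e : ℕ} (hp : p.Prime) [CharP K p] {s₀ : State (Fin 3) K} (hs : IsRoot (p ^ e) s₀)
    (W : ForcedWalk (p ^ e) s₀) (t : ℕ)
    (hst : (ifp W (t + 1)).muTilde (p ^ e) = (ifp W t).muTilde (p ^ e))
    (hst' : (ifp W (t + 1 + 1)).muTilde (p ^ e) = (ifp W (t + 1)).muTilde (p ^ e))
    (hj : W.j (t + 1) = W.j t) (hb : ∀ i, W.b (t + 1) i = 0) : CleanAt W t := by
  classical
  intro J₀ hJ₀ hμ d₀ hd₀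
  by_contra hunc
  have hgne : (ifp W t).gen J₀ ≠ 0 := by
    intro h0; rw [h0, ordZero_zero] at hd₀; exact ENat.top_ne_coe _ hd₀
  have ha : p ^ e - J₀.degree ≤ d₀ := by
    have := sing_ifp hp hs W t J₀ hJ₀ hgne
    rw [hd₀] at this; exact_mod_cast this
  have ha₀pos : 0 < p ^ e - J₀.degree := by have := (level_bounds W t J₀ hJ₀).2; omega
  obtain ⟨n, hn⟩ := exists_ordZero_eq_natCast (dirForm_ne_zero (W.j t) (W.b t) hd₀)
  have hrig := stall_rigid (p ^ e) (W.j t) (W.b t) (W.onExc t) (ifp W t) (fun J hJ => (level_bounds W t J hJ).2)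
    (sing_ifp hp hs W t) (by rw [← ifp_succ]; exact hst.symm.le) hJ₀ hμ hd₀
  obtain ⟨-, h2, h3, -, h5⟩ := hrig
  rw [hn, ENat.toNat_coe] at h2
  have hgen : (ifp W (t + 1)).gen J₀ =
      PointBlowup.translate (W.b t) (chartTransform (p ^ e - J₀.degree) (W.j t) ((ifp W t).gen J₀)) := by
    rw [ifp_succ]; rfl
  have hd' : ordZero ((ifp W (t + 1)).gen J₀) = ((d₀ - (p ^ e - J₀.degree) + n : ℕ) : ℕ∞) := by rw [ifp_succ]; exact h2
  have hstallval : ordZero (PointBlowup.translate (W.b t) (chartTransform (p ^ e - J₀.degree) (W.j t) ((ifp W t).gen J₀))) =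
      ((d₀ - (p ^ e - J₀.degree) + n : ℕ) : ℕ∞) := by rw [← hgen]; exact hd'
  -- resonance at `t`
  obtain ⟨m, hmn, -, hB0, hcone⟩ := resonance (W.b t) (W.onExc t) ha hd₀ hn hstallval hunc
  rw [← hgen] at hcone
  -- stall rigidity at `t + 1` for the same minimiser
  have hJ₀' : J₀ ∈ (ifp W (t + 1)).idx := by rw [idx_ifp] at hJ₀ ⊢; exact hJ₀
  have hμ' : (ifp W (t + 1)).muP (p ^ e) = levelRatio (ordZero ((ifp W (t + 1)).gen J₀)) (p ^ e - J₀.degree) := by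
    rw [ifp_succ]; exact h3
  have hrig' := stall_rigid (p ^ e) (W.j (t + 1)) (W.b (t + 1)) (W.onExc (t + 1)) (ifp W (t + 1))
    (fun J hJ => (level_bounds W (t + 1) J hJ).2) (sing_ifp hp hs W (t + 1))
    (by rw [← ifp_succ]; exact hst'.symm.le) hJ₀' hμ' hd'
  have h1' := hrig'.1
  -- the lost mass at `t + 1`: only the newest divisor `u_{j_t}`, of mass `d₀/a₀ − 1`
  have hjy : W.j t ∈ (ifp W (t + 1)).young := by rw [ifp_succ]; exact IFPState.mem_young_step (p ^ e) _ _ _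
  have hPD : (ifp W (t + 1)).muPD (p ^ e) (W.j t) = ((((d₀ : ℚ) / (p ^ e - J₀.degree : ℕ)) - 1 : ℚ) : WithTop ℚ) := by
    rw [ifp_succ]; exact h5
  have hlm : lostMass (p ^ e) (W.j (t + 1)) (W.b (t + 1)) (ifp W (t + 1)) = (d₀ : ℚ) / (p ^ e - J₀.degree : ℕ) - 1 := by
    unfold lostMass
    have hfilter : (ifp W (t + 1)).young.filter (fun i => i = W.j (t + 1) ∨ W.b (t + 1) i ≠ 0) = {W.j t} := by
      ext i
      simp only [Finset.mem_filter, Finset.mem_singleton, hb i, ne_eq, not_true_eq_false, or_false, hj]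
      constructor
      · exact fun h => h.2
      · intro h; rw [h]; exact ⟨hjy, rfl⟩
    rw [hfilter, Finset.sum_singleton, hPD, WithTop.untopD_coe]
  -- the echo inequality at `t + 1`
  have hordA : ordZero (homogeneousComponent n (dirForm d₀ (W.j t) (W.b t) ((ifp W t).gen J₀))) = n :=
    ordZero_homogeneousComponent (homogeneousComponent_ne_zero_of_ordZero_eq hn)
  have hAj : ∀ s ∈ (homogeneousComponent n (dirForm d₀ (W.j t) (W.b t) ((ifp W t).gen J₀))).support, s (W.j t) = 0 :=
    fun s hs => dirForm_free d₀ (W.b t) (W.onExc t) _ s (mem_support_of_mem_support_homogeneousComponent hs)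
  have hBdeg : ∀ s ∈ (homogeneousComponent m (tailForm d₀ (W.j t) (W.b t) ((ifp W t).gen J₀))).support,
      s.degree = m := fun s hs => degree_eq_of_mem_support_homogeneousComponent hs
  have hlt := ordZero_dirForm_two_layer hmn hordA hAj hBdeg hB0 hcone hb
  rw [← hj] at hlt
  -- combine with the rigid vertex law at `t + 1`
  obtain ⟨k, hk⟩ := exists_ordZero_eq_natCast (dirForm_ne_zero (W.j (t + 1)) (W.b (t + 1)) hd')
  rw [hk, ENat.toNat_coe, hlm] at h1'
  rw [hk] at hlt
  have hkn : k < n := by exact_mod_cast hlt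
  have ha₀q : (0 : ℚ) < ((p ^ e - J₀.degree : ℕ) : ℚ) := by exact_mod_cast ha₀pos
  have hcast : ((d₀ - (p ^ e - J₀.degree) + n : ℕ) : ℚ) = (d₀ : ℚ) - ((p ^ e - J₀.degree : ℕ) : ℚ) + n := by
    rw [Nat.cast_add, Nat.cast_sub ha]
  rw [hcast] at h1'
  have : (k : ℚ) = n := by
    rw [h1']; field_simp; ring
  have : k = n := by exact_mod_cast this
  omega

end Walk

end Summit.ResolutionOfSingularities.ResolutionOfSingularities.Theorems.StallVertex
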